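import Summits.CriticalPhenomena.PercolationContinuityZ3.Theses.PercNearOneGluing
import Summits.CriticalPhenomena.PercolationContinuityZ3.Theorems.PercNearOneGluingAdditiveGluingGoodStepStar
import Summits.CriticalPhenomena.PercolationContinuityZ3.Theorems.PercNearOneGluingAdditiveGluingGoodReliableNbrs
import Summits.CriticalPhenomena.PercolationContinuityZ3.Theorems.PercNearOneGluingAdditiveGluingKnLemma3Mixed
import HarnessLib

/-! # Crux `PercNearOneGluing.AdditiveGluing` (stmt-CriticalPhenomena-4576) — KN Lemma 3(i) under the order
# of `G ∖ o` (registered stub `stub_knLemma3iOffObserver_k28`, siege k28 file 3)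

Helper file (TTRL-lite deep seat on variant V1366 of `stub_goodStep` = Kozma–Nitzan arXiv:2401.12397 §5.5
Question 9 in the `b ∈ A` normalisation); lands with `--supports stmt-CriticalPhenomena-4576`.  No
definitions.  Notation: `μ = prodBernoulli w`, `τ°(x) = μ(x ↔ b in {o}ᶜ)`, `σ_B` = "the open star of `o`
is exactly `o–B`", `π_B` the pinned weighting, `w⁰` the star-deleted weighting.

**Theorem (`stub_knLemma3iOffObserver_k28`).** For `a₁, a₂, b ≠ o` with `τ°(a₁) ≤ τ°(a₂)`:
`μ(a₁ ↔ b, o ↔ a₂) ≤ μ(a₂ ↔ b, o ↔ a₂)` — KN Lemma 3(i) at `Q = {o ↔ a₂}` under the order of `G ∖ o`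
(the two-relay case of KN Question 9; the corollaries are in `…KnQuestion9TwoRelays`).

Proof (`σ_B`-decomposition): partition both sides by the open star of `o` (`sigmaRec_sum_preimage_inter`);
on `σ_B` conditioning is pinning (`goodStep_sigma_factor`), and under `π_B` the star is a.s. `o–B`; then
(`knQ9_walk_decomp`) `o ↔ a₂` iff `B ↔ a₂ in {o}ᶜ`, and `a₁ ↔ b` iff `a₁ ↔ b in {o}ᶜ` or (`B ↔ a₁` and
`B ↔ b` in `{o}ᶜ`).  These events are determined by the pairs inside `{o}ᶜ`, where `π_B = w⁰`
(`prodBernoulli_real_eq_of_determinedBy`), and `μ_{w⁰}`-a.s. `x ↔ y in {o}ᶜ` is `x ↔ y`.  Split by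
`{B ↔ a₁}`: on it both events say `B ↔ b`; off it the comparison
`μ⁰(a₁ ↔ b, B ↔ a₂, B ↮ a₁) ≤ μ⁰(B ↔ b, B ↔ a₂, B ↮ a₁)` is the landed mixed form of KN Lemma 3
(`knLemma3Mixed_setObserver_star`, van den Berg–Häggström–Kahn two-cluster association) under
`μ⁰(a₁ ↔ b) ≤ μ⁰(a₂ ↔ b)`, which is the hypothesis (`lemma5AnyRelay_real_openConnIn_compl_eq`).
-/

namespace Summit.CriticalPhenomena.PercolationContinuityZ3.Theorems

open MeasureTheory Set
open Literature.Probability.LatticeModels (prodBernoulli)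
open Literature.Probability.Percolation (BondConfig openConn openConnIn openGraph openCluster
  openGraph_adj DeterminedBy determinedBy_iff PathIn pinW openConnIn_subset_openConn)
open scoped BigOperators

noncomputable section
open Classical

variable {n : ℕ}

/-- `{x ↔ y in S}` is symmetric. [folklore] -/
theorem knQ9_openConnIn_symm {S : Set (Fin n)} {x y : Fin n} {ω : BondConfig (Fin n)}
    (h : ω ∈ openConnIn S x y) : ω ∈ openConnIn S y x := by
  obtain ⟨hx, hy, hr⟩ := h
  exact ⟨hy, hx, hr.symm⟩

/-- **Walk decomposition at the observer.**  If the open star of `o` is exactly `o–B` and `u ≠ o`,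
then an open walk from `u` to `v ≠ o` either stays inside `{o}ᶜ`, or `u` reaches some vertex of `B`
inside `{o}ᶜ` and some vertex of `B` reaches `v` inside `{o}ᶜ`; and an open walk from `u` to `o`
shows that `u` reaches a vertex of `B` inside `{o}ᶜ`. [folklore] -/
theorem knQ9_walk_decomp {ω : BondConfig (Fin n)} {o : Fin n} {B : Finset (Fin n)}
    (hstar : ∀ y : Fin n, y ≠ o → (s(o, y) ∈ ω ↔ y ∈ B)) {u : Fin n} (hu : u ≠ o) {v : Fin n}
    (h : Relation.ReflTransGen (openGraph ω).Adj u v) :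
    (v ≠ o → PathIn (openGraph ω) (({o} : Set (Fin n))ᶜ) u v ∨
      ((∃ y ∈ B, PathIn (openGraph ω) (({o} : Set (Fin n))ᶜ) u y) ∧
        ∃ y ∈ B, PathIn (openGraph ω) (({o} : Set (Fin n))ᶜ) y v)) ∧
    (v = o → ∃ y ∈ B, PathIn (openGraph ω) (({o} : Set (Fin n))ᶜ) u y) := by
  induction h with
  | refl => exact ⟨fun _ => Or.inl (PathIn.refl (Set.mem_compl_singleton_iff.2 hu)), fun h => absurd h hu⟩
  | @tail p q _ hpq ih =>
    obtain ⟨hmem, hne⟩ := (openGraph_adj ω p q).1 hpq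
    refine ⟨fun hqo => ?_, fun hqo => ?_⟩
    · have hqS : q ∈ (({o} : Set (Fin n))ᶜ) := Set.mem_compl_singleton_iff.2 hqo
      by_cases hpo : p = o
      · have hoq : s(o, q) ∈ ω := by rw [← hpo]; exact hmem
        have hqB : q ∈ B := (hstar q hqo).1 hoq
        obtain ⟨y, hyB, hy⟩ := ih.2 hpo
        exact Or.inr ⟨⟨y, hyB, hy⟩, q, hqB, PathIn.refl hqS⟩
      · rcases ih.1 hpo with hP | ⟨hY, y, hyB, hy⟩
        · exact Or.inl (hP.tail hpq hqS)
        · exact Or.inr ⟨hY, y, hyB, hy.tail hpq hqS⟩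
    · have hpo : p ≠ o := fun h => hne (h.trans hqo.symm)
      have hop : s(o, p) ∈ ω := by rw [Sym2.eq_swap, ← hqo]; exact hmem
      have hpB : p ∈ B := (hstar p hpo).1 hop
      rcases ih.1 hpo with hP | ⟨hY, -⟩
      · exact ⟨p, hpB, hP⟩
      · exact hY

/-- Star exactly `o–B`, `a ≠ o`: if `o ↔ a` then some `y ∈ B` is joined to `a` inside `{o}ᶜ`.
[folklore] -/
theorem knQ9_observer_reach {ω : BondConfig (Fin n)} {o a : Fin n} {B : Finset (Fin n)}
    (hstar : ∀ y : Fin n, y ≠ o → (s(o, y) ∈ ω ↔ y ∈ B)) (ha : a ≠ o)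
    (h : ω ∈ openConn o a) : ω ∈ ⋃ y ∈ B, openConnIn (({o} : Set (Fin n))ᶜ) y a := by
  have hr : (openGraph ω).Reachable a o := SimpleGraph.Reachable.symm h
  rw [SimpleGraph.reachable_iff_reflTransGen] at hr
  obtain ⟨y, hyB, hy⟩ := (knQ9_walk_decomp hstar ha hr).2 rfl
  exact Set.mem_iUnion₂.2 ⟨y, hyB, knQ9_openConnIn_symm
    (Literature.Probability.Percolation.DCT16.mem_openConnIn_of_pathIn hy)⟩

/-- Star exactly `o–B`, `a, b ≠ o`: if `a ↔ b` then `a ↔ b in {o}ᶜ`, or `B` is joined inside `{o}ᶜ`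
both to `a` and to `b`. [folklore] -/
theorem knQ9_conn_decomp {ω : BondConfig (Fin n)} {o a b : Fin n} {B : Finset (Fin n)}
    (hstar : ∀ y : Fin n, y ≠ o → (s(o, y) ∈ ω ↔ y ∈ B)) (ha : a ≠ o) (hb : b ≠ o)
    (h : ω ∈ openConn a b) :
    ω ∈ openConnIn (({o} : Set (Fin n))ᶜ) a b ∪
      ((⋃ y ∈ B, openConnIn (({o} : Set (Fin n))ᶜ) y a) ∩
        ⋃ y ∈ B, openConnIn (({o} : Set (Fin n))ᶜ) y b) := by
  have hr : (openGraph ω).Reachable a b := h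
  rw [SimpleGraph.reachable_iff_reflTransGen] at hr
  rcases (knQ9_walk_decomp hstar ha hr).1 hb with hP | ⟨⟨y₁, hy₁B, hy₁⟩, y₂, hy₂B, hy₂⟩
  · exact Or.inl (Literature.Probability.Percolation.DCT16.mem_openConnIn_of_pathIn hP)
  · exact Or.inr ⟨Set.mem_iUnion₂.2 ⟨y₁, hy₁B, knQ9_openConnIn_symm
        (Literature.Probability.Percolation.DCT16.mem_openConnIn_of_pathIn hy₁)⟩,
      Set.mem_iUnion₂.2 ⟨y₂, hy₂B, Literature.Probability.Percolation.DCT16.mem_openConnIn_of_pathIn hy₂⟩⟩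

/-- Star exactly `o–B` (`o ∉ B`): if some `y ∈ B` is joined to `x` inside `{o}ᶜ` then `o ↔ x`.
[folklore] -/
theorem knQ9_reach_observer {ω : BondConfig (Fin n)} {o x : Fin n} {B : Finset (Fin n)}
    (hoB : o ∉ B) (hstar : ∀ y : Fin n, y ≠ o → (s(o, y) ∈ ω ↔ y ∈ B))
    (h : ω ∈ ⋃ y ∈ B, openConnIn (({o} : Set (Fin n))ᶜ) y x) : ω ∈ openConn o x := by
  obtain ⟨y, hyB, hy⟩ := Set.mem_iUnion₂.1 h
  have hyo : y ≠ o := fun h => hoB (h ▸ hyB)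
  have hadj : (openGraph ω).Adj o y := (openGraph_adj ω o y).2 ⟨(hstar y hyo).2 hyB, hyo.symm⟩
  exact hadj.reachable.trans (openConnIn_subset_openConn _ y x hy)

/-- Binary unions preserve `DeterminedBy`. [folklore] -/
theorem knQ9_determinedBy_union {ι : Type*} {E E' : Set (Set ι)} {K : Set ι}
    (h : DeterminedBy E K) (h' : DeterminedBy E' K) : DeterminedBy (E ∪ E') K := by
  rw [determinedBy_iff] at h h' ⊢
  intro ω ω' hωω'
  rw [Set.mem_union, Set.mem_union, h ω ω' hωω', h' ω ω' hωω']

/-- **Core comparison under a weighting whose star at `o` is a.s. exactly `o–B`.**  Let `p` be a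
weighting under which a.s. the open star of `o` is `o–B` (`o ∉ B`), `w⁰` a weighting agreeing with `p`
on the pairs inside `{o}ᶜ` under which a.s. the star of `o` is closed, and suppose
`μ_{w⁰}(a₁ ↔ b) ≤ μ_{w⁰}(a₂ ↔ b)` (`a₁, a₂, b ≠ o`).  Then
`μ_p(a₁ ↔ b, o ↔ a₂) ≤ μ_p(a₂ ↔ b, o ↔ a₂)`.  (The quotient-graph form of KN Lemma 3(i) under the
deleted-observer order; see the module docstring.)
[cite: KozmaNitzan2024, Lemma 3 (pp. 6–7), §3.2 (p. 13) and Question 9 (p. 36)] -/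
theorem knQ9_pinned_core (p w0 : Sym2 (Fin n) → unitInterval) (o a₁ a₂ b : Fin n)
    (B : Finset (Fin n)) (hoB : o ∉ B) (h1o : a₁ ≠ o) (h2o : a₂ ≠ o) (hbo : b ≠ o)
    (hpstar : ∀ᵐ ω ∂prodBernoulli p, ∀ y : Fin n, y ≠ o → (s(o, y) ∈ ω ↔ y ∈ B))
    (hagree : ∀ e ∈ ((({o} : Set (Fin n))ᶜ).sym2), p e = w0 e)
    (h0star : ∀ᵐ ω ∂prodBernoulli w0, ∀ y : Fin n, y ≠ o → s(o, y) ∉ ω)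
    (hle0 : (prodBernoulli w0).real (openConn a₁ b) ≤ (prodBernoulli w0).real (openConn a₂ b)) :
    (prodBernoulli p).real (openConn a₁ b ∩ openConn o a₂) ≤
      (prodBernoulli p).real (openConn a₂ b ∩ openConn o a₂) := by
  -- the `{o}ᶜ`-events
  set S₀ : Set (Fin n) := ({o} : Set (Fin n))ᶜ with hS₀
  set U : Fin n → Set (BondConfig (Fin n)) := fun x => ⋃ y ∈ B, openConnIn S₀ y x with hU
  set L : Set (BondConfig (Fin n)) := (openConnIn S₀ a₁ b ∪ (U a₁ ∩ U b)) ∩ U a₂ with hL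
  set R : Set (BondConfig (Fin n)) := U b ∩ U a₂ with hR
  set H : Set (BondConfig (Fin n)) :=
    {ω | ∀ y : Fin n, y ≠ o → (s(o, y) ∈ ω ↔ y ∈ B)} with hH
  -- determinedness by the pairs inside `{o}ᶜ`
  have hPI : ∀ x y : Fin n, DeterminedBy (openConnIn S₀ x y) (S₀.sym2) := fun x y =>
    Literature.Probability.Percolation.DCT16.determinedBy_openConnIn S₀ x y subset_rfl
  have hUd : ∀ x : Fin n, DeterminedBy (U x) (S₀.sym2) := fun x =>
    goodStep_determinedBy_biUnion B fun y _ => hPI y x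
  have hLd : DeterminedBy L (S₀.sym2) :=
    (knQ9_determinedBy_union (hPI a₁ b) ((hUd a₁).inter (hUd b))).inter (hUd a₂)
  have hRd : DeterminedBy R (S₀.sym2) := (hUd b).inter (hUd a₂)
  -- (1) under `p`: `{a₁ ↔ b} ∩ {o ↔ a₂} ⊆ L` and `R ⊆ {a₂ ↔ b} ∩ {o ↔ a₂}` a.s.
  have hX₁ : (prodBernoulli p).real (openConn a₁ b ∩ openConn o a₂) =
      (prodBernoulli p).real (openConn a₁ b ∩ openConn o a₂ ∩ H) := by
    refine measureReal_congr ?_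
    filter_upwards [hpstar] with ω hω
    exact propext ⟨fun h => ⟨h, hω⟩, fun h => h.1⟩
  have hincl₁ : openConn a₁ b ∩ openConn o a₂ ∩ H ⊆ L := by
    rintro ω ⟨⟨hab, hoa⟩, hω⟩
    exact ⟨knQ9_conn_decomp hω h1o hbo hab, knQ9_observer_reach hω h2o hoa⟩
  have hR' : (prodBernoulli p).real R = (prodBernoulli p).real (R ∩ H) := by
    refine measureReal_congr ?_
    filter_upwards [hpstar] with ω hω
    exact propext ⟨fun h => ⟨h, hω⟩, fun h => h.1⟩
  have hincl₄ : R ∩ H ⊆ openConn a₂ b ∩ openConn o a₂ := by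
    rintro ω ⟨⟨hUb, hUa⟩, hω⟩
    have hob : ω ∈ openConn o b := knQ9_reach_observer hoB hω hUb
    have hoa : ω ∈ openConn o a₂ := knQ9_reach_observer hoB hω hUa
    exact ⟨SimpleGraph.Reachable.trans (SimpleGraph.Reachable.symm hoa) hob, hoa⟩
  -- (2) under `w0`: the comparison `μ⁰(L) ≤ μ⁰(R)`
  set Rb : Set (BondConfig (Fin n)) := {ω | ∃ y ∈ B, (openGraph ω).Reachable y b} with hRb
  set QS : Set (BondConfig (Fin n)) :=
    {ω | (∃ y ∈ B, (openGraph ω).Reachable a₂ y) ∧ ∀ y ∈ B, ¬ (openGraph ω).Reachable a₁ y} with hQS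
  set Q' : Set (BondConfig (Fin n)) :=
    {ω | (∃ y ∈ B, (openGraph ω).Reachable a₂ y) ∧ ∃ y ∈ B, (openGraph ω).Reachable a₁ y} with hQ'
  have hincl₂ : L ⊆ openConn a₁ b ∩ QS ∪ Rb ∩ Q' := by
    rintro ω ⟨hA, hUa₂⟩
    obtain ⟨y₂, hy₂B, hy₂⟩ := Set.mem_iUnion₂.1 hUa₂
    have hQ2 : ∃ y ∈ B, (openGraph ω).Reachable a₂ y :=
      ⟨y₂, hy₂B, SimpleGraph.Reachable.symm (openConnIn_subset_openConn _ y₂ a₂ hy₂)⟩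
    by_cases hN : ∃ y ∈ B, (openGraph ω).Reachable a₁ y
    · obtain ⟨y₁, hy₁B, hy₁⟩ := hN
      refine Or.inr ⟨?_, hQ2, y₁, hy₁B, hy₁⟩
      rcases hA with hP | ⟨-, hUb⟩
      · exact ⟨y₁, hy₁B, (SimpleGraph.Reachable.symm hy₁).trans (openConnIn_subset_openConn _ a₁ b hP)⟩
      · obtain ⟨y, hyB, hy⟩ := Set.mem_iUnion₂.1 hUb
        exact ⟨y, hyB, openConnIn_subset_openConn _ y b hy⟩
    · have hN' : ∀ y ∈ B, ¬ (openGraph ω).Reachable a₁ y := fun y hy h => hN ⟨y, hy, h⟩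
      refine Or.inl ⟨?_, hQ2, hN'⟩
      rcases hA with hP | ⟨hUa₁, -⟩
      · exact openConnIn_subset_openConn _ a₁ b hP
      · obtain ⟨y, hyB, hy⟩ := Set.mem_iUnion₂.1 hUa₁
        exact absurd (SimpleGraph.Reachable.symm (openConnIn_subset_openConn _ y a₁ hy)) (hN' y hyB)
  have hM₁ : (prodBernoulli w0).real (openConn a₁ b ∩ QS) ≤ (prodBernoulli w0).real (Rb ∩ QS) := by
    have h := knLemma3Mixed_setObserver_star n w0 a₁ a₂ b B 0 le_rfl (by rw [add_zero]; exact hle0)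
    rw [add_zero] at h
    exact h
  have hdisj : Disjoint (Rb ∩ QS) (Rb ∩ Q') := by
    refine Set.disjoint_left.2 ?_
    rintro ω ⟨-, -, hno⟩ ⟨-, -, y, hyB, hy⟩
    exact hno y hyB hy
  have hincl₃' : Rb ∩ QS ∪ Rb ∩ Q' ⊆ Rb ∩ {ω | ∃ y ∈ B, (openGraph ω).Reachable a₂ y} := by
    rintro ω (⟨hb, hq, -⟩ | ⟨hb, hq, -⟩)
    · exact ⟨hb, hq⟩
    · exact ⟨hb, hq⟩
  have hK : (prodBernoulli w0).real (Rb ∩ {ω | ∃ y ∈ B, (openGraph ω).Reachable a₂ y}) =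
      (prodBernoulli w0).real
        (Rb ∩ {ω | ∃ y ∈ B, (openGraph ω).Reachable a₂ y} ∩
          {ω | ∀ y : Fin n, y ≠ o → s(o, y) ∉ ω}) := by
    refine measureReal_congr ?_
    filter_upwards [h0star] with ω hω
    exact propext ⟨fun h => ⟨h, hω⟩, fun h => h.1⟩
  have hincl₃ : Rb ∩ {ω | ∃ y ∈ B, (openGraph ω).Reachable a₂ y} ∩
      {ω | ∀ y : Fin n, y ≠ o → s(o, y) ∉ ω} ⊆ R := by
    rintro ω ⟨⟨⟨y, hyB, hyb⟩, y', hy'B, hy'⟩, hω⟩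
    have hstep : ∀ p q, (openGraph ω).Adj p q → q ≠ o := fun p q hpq hq => by
      rw [openGraph_adj, hq, Sym2.eq_swap] at hpq
      exact hω p hpq.2 hpq.1
    have hyo : y ≠ o := fun h => hoB (h ▸ hyB)
    have hy'o : y' ≠ o := fun h => hoB (h ▸ hy'B)
    refine ⟨Set.mem_iUnion₂.2 ⟨y, hyB, ?_⟩, Set.mem_iUnion₂.2 ⟨y', hy'B, ?_⟩⟩
    · exact Literature.Probability.Percolation.DCT16.mem_openConnIn_of_pathIn
        (lemma5AnyRelay_pathIn_compl hyo hstep hyb)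
    · exact Literature.Probability.Percolation.DCT16.mem_openConnIn_of_pathIn
        (lemma5AnyRelay_pathIn_compl hy'o hstep (SimpleGraph.Reachable.symm hy'))
  -- (3) the chain
  calc (prodBernoulli p).real (openConn a₁ b ∩ openConn o a₂)
      = (prodBernoulli p).real (openConn a₁ b ∩ openConn o a₂ ∩ H) := hX₁
    _ ≤ (prodBernoulli p).real L := measureReal_mono hincl₁ (measure_ne_top _ _)
    _ = (prodBernoulli w0).real L :=
        Literature.Probability.LatticeModels.prodBernoulli_real_eq_of_determinedBy p w0 hagree hLd
          MeasurableSet.of_discrete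
    _ ≤ (prodBernoulli w0).real (openConn a₁ b ∩ QS ∪ Rb ∩ Q') :=
        measureReal_mono hincl₂ (measure_ne_top _ _)
    _ ≤ (prodBernoulli w0).real (openConn a₁ b ∩ QS) + (prodBernoulli w0).real (Rb ∩ Q') :=
        measureReal_union_le _ _
    _ ≤ (prodBernoulli w0).real (Rb ∩ QS) + (prodBernoulli w0).real (Rb ∩ Q') :=
        add_le_add_left hM₁ _
    _ = (prodBernoulli w0).real (Rb ∩ QS ∪ Rb ∩ Q') :=
        (measureReal_union hdisj MeasurableSet.of_discrete (measure_ne_top _ _) (measure_ne_top _ _)).symm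
    _ ≤ (prodBernoulli w0).real (Rb ∩ {ω | ∃ y ∈ B, (openGraph ω).Reachable a₂ y}) :=
        measureReal_mono hincl₃' (measure_ne_top _ _)
    _ = (prodBernoulli w0).real
          (Rb ∩ {ω | ∃ y ∈ B, (openGraph ω).Reachable a₂ y} ∩
            {ω | ∀ y : Fin n, y ≠ o → s(o, y) ∉ ω}) := hK
    _ ≤ (prodBernoulli w0).real R := measureReal_mono hincl₃ (measure_ne_top _ _)
    _ = (prodBernoulli p).real R :=
        (Literature.Probability.LatticeModels.prodBernoulli_real_eq_of_determinedBy p w0 hagree hRd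
          MeasurableSet.of_discrete).symm
    _ = (prodBernoulli p).real (R ∩ H) := hR'
    _ ≤ (prodBernoulli p).real (openConn a₂ b ∩ openConn o a₂) :=
        measureReal_mono hincl₄ (measure_ne_top _ _)

/-- Registered sub-goal `stub_knLemma3iOffObserver_k28` of stmt-CriticalPhenomena-4576: **Kozma–Nitzan
Lemma 3(i) at `Q = {o ↔ a₂}` under the order of `G ∖ o`** — if `a₁, a₂, b ≠ o` and
`μ(a₁ ↔ b in {o}ᶜ) ≤ μ(a₂ ↔ b in {o}ᶜ)` then `μ(a₁ ↔ b, o ↔ a₂) ≤ μ(a₂ ↔ b, o ↔ a₂)`.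
Proof: `σ_B`-decomposition of both sides over the open star of `o`; on each fibre conditioning is
pinning and `knQ9_pinned_core` applies (star-deleted weighting `w⁰`, hypothesis transported by
`lemma5AnyRelay_real_openConnIn_compl_eq`).
[cite: KozmaNitzan2024, Lemma 3 (pp. 6–7) and Question 9 (p. 36)] -/
theorem stub_knLemma3iOffObserver_k28 :
    ∀ (n : ℕ) (w : Sym2 (Fin n) → unitInterval) (o a₁ a₂ b : Fin n), a₁ ≠ o → a₂ ≠ o → b ≠ o →
      (prodBernoulli w).real (openConnIn (({o} : Set (Fin n))ᶜ) a₁ b) ≤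
        (prodBernoulli w).real (openConnIn (({o} : Set (Fin n))ᶜ) a₂ b) →
      (prodBernoulli w).real (openConn a₁ b ∩ openConn o a₂) ≤
        (prodBernoulli w).real (openConn a₂ b ∩ openConn o a₂) := by
  intro n w o a₁ a₂ b h1o h2o hbo hle
  -- the star-deleted weighting and the hypothesis in `w⁰`-form
  have hW1 := goodStep_del_offstar w o
  have hW2 : ∀ y : Fin n, y ≠ o →
      (fun e : Sym2 (Fin n) => if o ∈ e then (0 : unitInterval) else w e) s(o, y) = 0 :=
    fun y _ => if_pos (Sym2.mem_mk_left o y)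
  have hle0 : (prodBernoulli fun e : Sym2 (Fin n) => if o ∈ e then (0 : unitInterval) else w e).real
        (openConn a₁ b) ≤
      (prodBernoulli fun e : Sym2 (Fin n) => if o ∈ e then (0 : unitInterval) else w e).real
        (openConn a₂ b) := by
    rw [← lemma5AnyRelay_real_openConnIn_compl_eq w _ o a₁ b h1o hW1 hW2,
      ← lemma5AnyRelay_real_openConnIn_compl_eq w _ o a₂ b h2o hW1 hW2]
    exact hle
  -- partition by the open star of `o`
  set f : BondConfig (Fin n) → Finset (Fin n) :=
    fun ω => Finset.univ.filter fun y : Fin n => y ≠ o ∧ s(o, y) ∈ ω with hf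
  rw [← sigmaRec_sum_preimage_inter w f (openConn a₁ b ∩ openConn o a₂),
    ← sigmaRec_sum_preimage_inter w f (openConn a₂ b ∩ openConn o a₂)]
  refine Finset.sum_le_sum fun B _ => ?_
  by_cases hoB : o ∈ B
  · rw [hf, goodBase_fibre_eq_empty o B hoB, Set.empty_inter, Set.empty_inter]
  rw [hf, goodBase_fibre_eq o B hoB]
  -- conditioning on `σ_B` is pinning
  have hF : ∀ e : Sym2 (Fin n),
      e ∈ (Finset.univ.filter fun e : Sym2 (Fin n) => o ∈ e ∧ ¬ e.IsDiag) ↔ o ∈ e ∧ ¬ e.IsDiag :=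
    fun e => by simp
  obtain ⟨ξ, hξ⟩ : ∃ ξ : Set (Sym2 (Fin n)), ∀ y : Fin n, s(o, y) ∈ ξ ↔ y ∈ B := by
    refine ⟨(fun y => s(o, y)) '' ↑B, fun y => ?_⟩
    rw [Function.Injective.mem_set_image fun y y' h => Sym2.congr_right.1 h, Finset.mem_coe]
  rw [goodStep_sigma_factor w hF hξ, goodStep_sigma_factor w hF hξ]
  refine mul_le_mul_of_nonneg_left ?_ measureReal_nonneg
  refine knQ9_pinned_core _ _ o a₁ a₂ b B hoB h1o h2o hbo (goodStep_pin_ae_star w hF hξ)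
    (fun e he => (goodStep_pin_offstar w hF ξ e he).trans (hW1 e he)) (goodStep_del_ae_isolated w o) hle0

end

end Summit.CriticalPhenomena.PercolationContinuityZ3.Theorems
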